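import Summits.CriticalPhenomena.PercolationContinuityZ3.Theorems.PercNearOneGluingNoHeavyLowerTailEventGluingSharp
import Summits.CriticalPhenomena.PercolationContinuityZ3.Theorems.PercNearOneGluingNoHeavyQuantLowerTailGluing
import HarnessLib

/-!
# QUANT lane R1 (census-1): the linear lower tail is governed by the WORST RELAY, and `C = 1` holds at the first layer (`EN ≤ 4`)

Support file (`--supports stmt-CriticalPhenomena-4575`), seat `prim-quant-census-1` (CENSUS DESIGN 1, gen 2);
builds on p205010 (kernel theorem, internal audit signed; external expert review pending).  No definitions, no named facts, no sorries;
standard axioms.  Notation: `N_x(ω) = #{a ∈ A : x ↔ a in ω}` (written out as `(A.filter fun a => ω ∈ openConn x a).card`),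
`EN = Σ_{a∈A} μ(o ↔ a)`, `{o ↔ A} = ⋃_{a∈A} {o ↔ a}`.

The census memo `run/shared/lean/prim/quant/CENSUS-GAIN.md` (v5, §3.7/§10) pins the sharp constant of the linear lower tail
`μ(1 ≤ N_o < EN/2) ≤ C·τ·μ(o ↔ A)` (`τ = max_{a≠a'} μ(a ↮ a')`) empirically at `C* = 1` (exhaustive exact census n ≤ 7, two engines,
continuous-weight climbs; the tree has `C = 2`: `QuantGluing.linearLowerTail_two_mean`, and `C ≥ 1`:
`QuantGluing.quantLowerTailGluing_false_of_lt_one`).  This file lands the reduction every proof attempt of `C = 1` uses, and the first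
layer of the conjecture as a theorem:

* `lowerTail_le_worstRelay` — **(GEN-reduction)** for every threshold `c : ℕ`: if `μ(N_a < c) ≤ s` for every relay `a ∈ A`, then
  `μ({o ↔ A} ∩ {N_o < c}) ≤ s·μ(o ↔ A)`.  (The tree's master inequality `EventGluingSharp.gen_holds` at the monotone functional
  `F = 1{c ≤ |· ∩ A|}` with an `μ(N_· ≥ c)`-compatible rank; the first-in-rank patterns partition `{o ↔ A}`.)  So the observer's lower
  tail at ANY threshold is at most the worst relay's own lower tail at that threshold — the o-free criterion `MIN(c)` of the memo.
* `lowerTail_lt_two_le` — the first layer: `μ({o ↔ A} ∩ {N_o < 2}) ≤ s·μ(o ↔ A)` whenever `μ(a ↮ a') ≤ s` on `A × A` and `|A| ≥ 2`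
  (a relay joined to no other relay is in particular not joined to a fixed second relay).
* `linearLowerTail_mean_one_of_EN_le_four` — **`C = 1` whenever `EN ≤ 4`** (then `N < EN/2` forces `N ≤ 1`):
  `μ(1 ≤ N ∧ N < EN/2) ≤ s·μ(o ↔ A)`; in particular for every relay set with `|A| ≤ 4` (`linearLowerTail_mean_one_of_card_le_four`),
  and in the binder shape of the typed family `Quant.QuantLowerTailGluingAt (1/2) 1` restricted to `EN ≤ 4`
  (`quantLowerTailGluing_one_of_EN_le_four`: `… ≤ 1·(μ(o ↮ A) + s)`).
What remains open for `Quant.QuantLowerTailGluing 1` is exactly the o-free statement `μ(N_a < c) ≤ τ` for `2 < c ≤ ⌈EN_o/2⌉`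
(memo §10: MIN-EN; census sup `= 1⁻`, no counterexample through n ≤ 7 and continuous climbs n ≤ 6).
Addendum (same seat, same day): the conditional reductions making this precise in the tree —
`linearLowerTail_mean_one_of_minRelay` (MIN-EN′ for the given observer ⟹ `μ(1 ≤ N < EN/2) ≤ s·μ(o ↔ A)`) and
`quantLowerTailGluing_one_of_minRelay` (MIN-EN′ on every graph ⟹ `Quant.QuantLowerTailGluing 1`).
[cite: KozmaNitzan2024, Conj. 1 (p. 3), Conjecture 3 (p. 15), Conj. 4 (p. 32)]
-/

noncomputable section

namespace Summit.CriticalPhenomena.PercolationContinuityZ3.Theorems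

open MeasureTheory Set
open Literature.Probability.LatticeModels (prodBernoulli)
open Literature.Probability.Percolation
open scoped Classical

namespace QuantCensus

/-- **(GEN-reduction) the observer's lower tail is at most the worst relay's lower tail**, on every finite weighted graph and for
every threshold `c`: if `μ(#{a' ∈ A : a ↔ a'} < c) ≤ s` for every `a ∈ A`, then `μ({o ↔ A} ∩ {#{a ∈ A : o ↔ a} < c}) ≤ s·μ(o ↔ A)`.
Proof: `EventGluingSharp.gen_holds` with `F(M) = 1{c ≤ |M ∩ A|}` (monotone, nonnegative) and a rank compatible with
`a ↦ μ(N_a ≥ c)` gives `Σ_a μ(P_a)·μ(N_a ≥ c) ≤ μ({o ↔ A} ∩ {N_o ≥ c})`, the first-in-rank patterns `P_a` have total mass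
`μ(o ↔ A)` (`AGloc.sum_measureReal_firstRank`), and `μ(N_a ≥ c) ≥ 1 − s`. [cite: KozmaNitzan2024, Conj. 4 (p. 32)] -/
theorem lowerTail_le_worstRelay (n : ℕ) (w : Sym2 (Fin n) → unitInterval) (A : Finset (Fin n)) (o : Fin n) (c : ℕ) (s : ℝ)
    (hs : ∀ a ∈ A, (prodBernoulli w).real {ω : BondConfig (Fin n) | (A.filter fun a' => ω ∈ openConn a a').card < c} ≤ s) :
    (prodBernoulli w).real ((⋃ a ∈ A, openConn o a) ∩
        {ω : BondConfig (Fin n) | (A.filter fun a => ω ∈ openConn o a).card < c}) ≤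
      s * (prodBernoulli w).real (⋃ a ∈ A, openConn o a) := by
  set μ := prodBernoulli w with hμ
  have hmeas : ∀ S : Set (BondConfig (Fin n)), MeasurableSet S := fun S => (Set.toFinite S).measurableSet
  -- the events `G x = {N_x ≥ c}`
  set G : Fin n → Set (BondConfig (Fin n)) := fun x => {ω | c ≤ (A.filter fun a => ω ∈ openConn x a).card} with hG
  -- the monotone cluster functional `F(M) = 1{c ≤ |M ∩ A|}`
  set F : Set (Fin n) → ℝ := fun M => if c ≤ (A.filter fun a => a ∈ M).card then 1 else 0 with hFdef
  have hFmono : ∀ S T : Set (Fin n), S ⊆ T → F S ≤ F T := by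
    intro S T hST
    have hsub : (A.filter fun a => a ∈ S) ⊆ (A.filter fun a => a ∈ T) := by
      intro x hx
      rw [Finset.mem_filter] at hx ⊢
      exact ⟨hx.1, hST hx.2⟩
    have hcard := Finset.card_le_card hsub
    simp only [hFdef]
    by_cases hS : c ≤ (A.filter fun a => a ∈ S).card
    · rw [if_pos hS, if_pos (hS.trans hcard)]
    · rw [if_neg hS]
      split_ifs <;> norm_num
  have hF0 : ∀ S, 0 ≤ F S := by
    intro S
    simp only [hFdef]
    split_ifs <;> norm_num
  have hFind : ∀ x : Fin n, (fun ω : BondConfig (Fin n) => F (openCluster ω x)) = (G x).indicator 1 := by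
    intro x
    funext ω
    have hfilt : (A.filter fun a => a ∈ openCluster ω x) = (A.filter fun a => ω ∈ openConn x a) :=
      Finset.filter_congr fun a _ => Iff.rfl
    simp only [hFdef, hfilt]
    by_cases hω : ω ∈ G x
    · rw [Set.indicator_of_mem hω, Pi.one_apply, if_pos (show c ≤ _ from hω)]
    · rw [Set.indicator_of_notMem hω, if_neg (show ¬ c ≤ _ from hω)]
  have hint : ∀ x : Fin n, ∫ ω, F (openCluster ω x) ∂μ = μ.real (G x) := by
    intro x
    rw [hFind x, integral_indicator_one (hmeas _)]
  have hsetint : ∫ ω in (⋃ a ∈ A, openConn o a), F (openCluster ω o) ∂μ =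
      μ.real ((⋃ a ∈ A, openConn o a) ∩ G o : Set (BondConfig (Fin n))) := by
    rw [hFind o, ← integral_indicator (hmeas _), Set.indicator_indicator, integral_indicator_one ((hmeas _).inter (hmeas _))]
  -- a compatible injective rank and the master inequality (GEN)
  obtain ⟨r, hr, hrc⟩ := AGloc.exists_rank_compat A (fun a => μ.real (G a))
  have hcompat : ∀ a ∈ A, ∀ a' ∈ A, r a < r a' →
      ∫ ω, F (openCluster ω a) ∂μ ≤ ∫ ω, F (openCluster ω a') ∂μ := by
    intro a ha a' ha' hlt
    rw [hint a, hint a']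
    exact hrc a ha a' ha' hlt
  have key := EventGluingSharp.gen_holds n w A o F r hFmono hF0 hr hcompat
  rw [← hμ] at key
  simp only [hint] at key
  rw [hsetint] at key
  -- `μ(G a) ≥ 1 - s` for every relay, so `(1 - s)·μ(o ↔ A) ≤ Σ_a μ(P_a)·μ(G a)`
  have hGa : ∀ a ∈ A, 1 - s ≤ μ.real (G a) := by
    intro a ha
    have hcomp : (G a)ᶜ = {ω : BondConfig (Fin n) | (A.filter fun a' => ω ∈ openConn a a').card < c} := by
      ext ω
      simp only [hG, Set.mem_compl_iff, Set.mem_setOf_eq, not_le]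
    have h := hs a ha
    rw [← hcomp, probReal_compl_eq_one_sub (hmeas _)] at h
    linarith
  have hsum := AGloc.sum_measureReal_firstRank w A r o hr
  rw [← hμ] at hsum
  have hlow : ∑ a ∈ A, μ.real (openConn o a ∩ ⋂ a' ∈ A.filter (fun a' => r a' < r a), (openConn o a')ᶜ :
        Set (BondConfig (Fin n))) * (1 - s) ≤
      ∑ a ∈ A, μ.real (openConn o a ∩ ⋂ a' ∈ A.filter (fun a' => r a' < r a), (openConn o a')ᶜ :
        Set (BondConfig (Fin n))) * μ.real (G a) :=
    Finset.sum_le_sum fun a ha => mul_le_mul_of_nonneg_left (hGa a ha) measureReal_nonneg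
  rw [← Finset.sum_mul, hsum] at hlow
  -- split `{o ↔ A}` along `G o`
  have hsplit := measureReal_inter_add_sdiff (μ := μ) (s := ⋃ a ∈ A, (openConn o a : Set (BondConfig (Fin n))))
    (hmeas (G o)) (measure_ne_top _ _)
  have hdiff : (⋃ a ∈ A, (openConn o a : Set (BondConfig (Fin n)))) \ G o =
      (⋃ a ∈ A, openConn o a) ∩ {ω : BondConfig (Fin n) | (A.filter fun a => ω ∈ openConn o a).card < c} := by
    ext ω
    simp only [hG, Set.mem_sdiff, Set.mem_inter_iff, Set.mem_setOf_eq, not_le]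
  rw [hdiff] at hsplit
  nlinarith [key, hlow, hsplit]

/-- **First layer: an observer that reaches `A` reaches at least two relays, up to the pairwise slack.**  If `|A| ≥ 2` and
`μ(a ↮ a') ≤ s` for all `a, a' ∈ A`, then `μ({o ↔ A} ∩ {#{a ∈ A : o ↔ a} < 2}) ≤ s·μ(o ↔ A)`: a relay joined to fewer than two
relays (itself included) is not joined to any fixed second relay, so `μ(N_a < 2) ≤ s`, and `lowerTail_le_worstRelay` applies.
[cite: KozmaNitzan2024, Conj. 1 (p. 3)] -/
theorem lowerTail_lt_two_le (n : ℕ) (w : Sym2 (Fin n) → unitInterval) (A : Finset (Fin n)) (o : Fin n) (s : ℝ)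
    (hA : 2 ≤ A.card)
    (hs : ∀ a ∈ A, ∀ a' ∈ A, (prodBernoulli w).real (openConn a a' : Set (BondConfig (Fin n)))ᶜ ≤ s) :
    (prodBernoulli w).real ((⋃ a ∈ A, openConn o a) ∩
        {ω : BondConfig (Fin n) | (A.filter fun a => ω ∈ openConn o a).card < 2}) ≤
      s * (prodBernoulli w).real (⋃ a ∈ A, openConn o a) := by
  refine lowerTail_le_worstRelay n w A o 2 s fun a ha => ?_
  obtain ⟨a', ha', hne⟩ := Finset.exists_mem_ne (lt_of_lt_of_le one_lt_two hA) a
  refine (measureReal_mono ?_ (measure_ne_top _ _)).trans (hs a ha a' ha')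
  intro ω hω
  simp only [Set.mem_setOf_eq] at hω
  intro hconn
  have hself : ω ∈ (openConn a a : Set (BondConfig (Fin n))) := SimpleGraph.Reachable.refl a
  have hpair : ({a, a'} : Finset (Fin n)) ⊆ A.filter fun x => ω ∈ openConn a x := by
    intro x hx
    rw [Finset.mem_insert, Finset.mem_singleton] at hx
    rw [Finset.mem_filter]
    rcases hx with rfl | rfl
    · exact ⟨ha, hself⟩
    · exact ⟨ha', hconn⟩
  have hcard := Finset.card_le_card hpair
  rw [Finset.card_pair hne.symm] at hcard
  omega

/-- **The sharp constant `C = 1` at the first layer (`EN ≤ 4`)**: if `μ(a ↮ a') ≤ s` for all `a, a' ∈ A` and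
`EN = Σ_{a∈A} μ(o ↔ a) ≤ 4`, then `μ(1 ≤ N ∧ N < EN/2) ≤ s·μ(o ↔ A)` — the event forces `o ↔ A` and `N ≤ 1 < 2`.
(The tree's constant for all `EN` is `2`: `QuantGluing.linearLowerTail_two_mean`; `1` is sharp: pendant-to-blob equality family,
`QuantGluing.quantLowerTailGluing_false_of_lt_one`.) [cite: KozmaNitzan2024, Conj. 1 (p. 3), Conjecture 3 (p. 15)] -/
theorem linearLowerTail_mean_one_of_EN_le_four (n : ℕ) (w : Sym2 (Fin n) → unitInterval) (A : Finset (Fin n)) (o : Fin n)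
    (s : ℝ) (hs : ∀ a ∈ A, ∀ a' ∈ A, (prodBernoulli w).real (openConn a a' : Set (BondConfig (Fin n)))ᶜ ≤ s)
    (hEN : ∑ a ∈ A, (prodBernoulli w).real (openConn o a) ≤ 4) :
    (prodBernoulli w).real {ω : BondConfig (Fin n) | 1 ≤ (A.filter fun a => ω ∈ openConn o a).card ∧
        ((A.filter fun a => ω ∈ openConn o a).card : ℝ) <
          1 / 2 * ∑ a ∈ A, (prodBernoulli w).real (openConn o a)} ≤
      s * (prodBernoulli w).real (⋃ a ∈ A, openConn o a) := by
  set μ := prodBernoulli w with hμ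
  set E : Set (BondConfig (Fin n)) := {ω | 1 ≤ (A.filter fun a => ω ∈ openConn o a).card ∧
      ((A.filter fun a => ω ∈ openConn o a).card : ℝ) < 1 / 2 * ∑ a ∈ A, μ.real (openConn o a)} with hE
  set U : Set (BondConfig (Fin n)) := ⋃ a ∈ A, openConn o a with hU
  by_cases hA : 2 ≤ A.card
  · -- `E ⊆ {o ↔ A} ∩ {N < 2}`
    have hsub : E ⊆ U ∩ {ω : BondConfig (Fin n) | (A.filter fun a => ω ∈ openConn o a).card < 2} := by
      intro ω hω
      obtain ⟨h1, h2⟩ := hω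
      refine ⟨?_, ?_⟩
      · obtain ⟨a, ha⟩ := Finset.card_pos.1 h1
        rw [Finset.mem_filter] at ha
        exact Set.mem_biUnion (Finset.mem_coe.2 ha.1) ha.2
      · simp only [Set.mem_setOf_eq]
        have h3 : ((A.filter fun a => ω ∈ openConn o a).card : ℝ) < 2 := by linarith
        exact_mod_cast h3
    exact (measureReal_mono hsub (measure_ne_top _ _)).trans (lowerTail_lt_two_le n w A o s hA hs)
  · -- `|A| ≤ 1`: then `EN ≤ |A| ≤ 1` and the event is empty
    have hA1 : A.card ≤ 1 := by omega
    have hENle : ∑ a ∈ A, μ.real (openConn o a) ≤ 1 := by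
      calc ∑ a ∈ A, μ.real (openConn o a) ≤ ∑ a ∈ A, (1 : ℝ) := Finset.sum_le_sum fun a _ => measureReal_le_one
        _ = A.card := by simp
        _ ≤ 1 := by exact_mod_cast hA1
    have hE0 : E = ∅ := by
      rw [Set.eq_empty_iff_forall_notMem]
      intro ω hω
      obtain ⟨h1, h2⟩ := hω
      have h1' : (1 : ℝ) ≤ (A.filter fun a => ω ∈ openConn o a).card := by exact_mod_cast h1
      linarith
    rw [hE0, measureReal_empty]
    rcases A.eq_empty_or_nonempty with hAe | ⟨a, ha⟩
    · have hU0 : μ.real U = 0 := by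
        have : U = ∅ := by rw [hU, hAe]; simp
        rw [this, measureReal_empty]
      rw [hU0, mul_zero]
    · have hs0 : 0 ≤ s := le_trans measureReal_nonneg (hs a ha a ha)
      exact mul_nonneg hs0 measureReal_nonneg

/-- **`C = 1` for every relay set with at most four relays** (`EN ≤ |A| ≤ 4`). [cite: KozmaNitzan2024, Conjecture 3 (p. 15)] -/
theorem linearLowerTail_mean_one_of_card_le_four (n : ℕ) (w : Sym2 (Fin n) → unitInterval) (A : Finset (Fin n)) (o : Fin n)
    (s : ℝ) (hA : A.card ≤ 4)
    (hs : ∀ a ∈ A, ∀ a' ∈ A, (prodBernoulli w).real (openConn a a' : Set (BondConfig (Fin n)))ᶜ ≤ s) :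
    (prodBernoulli w).real {ω : BondConfig (Fin n) | 1 ≤ (A.filter fun a => ω ∈ openConn o a).card ∧
        ((A.filter fun a => ω ∈ openConn o a).card : ℝ) <
          1 / 2 * ∑ a ∈ A, (prodBernoulli w).real (openConn o a)} ≤
      s * (prodBernoulli w).real (⋃ a ∈ A, openConn o a) := by
  refine linearLowerTail_mean_one_of_EN_le_four n w A o s hs ?_
  calc ∑ a ∈ A, (prodBernoulli w).real (openConn o a) ≤ ∑ a ∈ A, (1 : ℝ) :=
        Finset.sum_le_sum fun a _ => measureReal_le_one
    _ = A.card := by simp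
    _ ≤ 4 := by exact_mod_cast hA

/-- **The typed family's binder shape at `C = 1`, first layer**: for `o ∉ A`, `0 ≤ s` bounding every `μ(a ↮ a')` and `EN ≤ 4`,
`μ(1 ≤ N < EN/2) ≤ 1·(μ(o ↮ A) + s)` — i.e. the instance of `Quant.QuantLowerTailGluingAt (1/2) 1` on every relay set with
`EN ≤ 4` (in particular `|A| ≤ 4`); the full `Quant.QuantLowerTailGluing 1` is the lane's open sharp-constant conjecture.
[cite: KozmaNitzan2024, Conjecture 3 (p. 15)] -/
theorem quantLowerTailGluing_one_of_EN_le_four (n : ℕ) (w : Sym2 (Fin n) → unitInterval) (A : Finset (Fin n)) (o : Fin n)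
    (s : ℝ) (_ho : o ∉ A) (hs0 : 0 ≤ s)
    (hs : ∀ a ∈ A, ∀ a' ∈ A, (prodBernoulli w).real (openConn a a' : Set (BondConfig (Fin n)))ᶜ ≤ s)
    (hEN : ∑ a ∈ A, (prodBernoulli w).real (openConn o a) ≤ 4) :
    (prodBernoulli w).real {ω : BondConfig (Fin n) | 1 ≤ (A.filter fun a => ω ∈ openConn o a).card ∧
        ((A.filter fun a => ω ∈ openConn o a).card : ℝ) <
          1 / 2 * ∑ a ∈ A, (prodBernoulli w).real (openConn o a)} ≤
      1 * ((prodBernoulli w).real (⋃ a ∈ A, openConn o a)ᶜ + s) := by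
  have h := linearLowerTail_mean_one_of_EN_le_four n w A o s hs hEN
  have hU1 : (prodBernoulli w).real (⋃ a ∈ A, (openConn o a : Set (BondConfig (Fin n)))) ≤ 1 := measureReal_le_one
  have hc0 : 0 ≤ (prodBernoulli w).real (⋃ a ∈ A, (openConn o a : Set (BondConfig (Fin n))))ᶜ := measureReal_nonneg
  nlinarith [h, hU1, hc0, hs0]

/-- **The open core, isolated (MIN-EN′ ⟹ C = 1 for this observer)**: if for the given observer `o` every relay `a ∈ A` satisfies
`μ(#{x ∈ A : a ↔ x} < EN_o/2) ≤ s` (the relay's own cluster falls below HALF THE OBSERVER'S MEAN with probability at most `s`), then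
`μ(1 ≤ N_o ∧ N_o < EN_o/2) ≤ s·μ(o ↔ A)` — `lowerTail_le_worstRelay` at the integer threshold `c = ⌈EN_o/2⌉₊` (`N < EN/2 ↔ N < ⌈EN/2⌉₊`).
The hypothesis is the census memo's MIN-EN′ (CENSUS-GAIN.md §10.6; census sup `= 1⁻`, no counterexample), the only open ingredient of
`Quant.QuantLowerTailGluing 1`. [cite: KozmaNitzan2024, Conjecture 3 (p. 15), Conj. 4 (p. 32)] -/
theorem linearLowerTail_mean_one_of_minRelay (n : ℕ) (w : Sym2 (Fin n) → unitInterval) (A : Finset (Fin n)) (o : Fin n) (s : ℝ)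
    (hmin : ∀ a ∈ A, (prodBernoulli w).real {ω : BondConfig (Fin n) |
        ((A.filter fun x => ω ∈ openConn a x).card : ℝ) < 1 / 2 * ∑ x ∈ A, (prodBernoulli w).real (openConn o x)} ≤ s) :
    (prodBernoulli w).real {ω : BondConfig (Fin n) | 1 ≤ (A.filter fun a => ω ∈ openConn o a).card ∧
        ((A.filter fun a => ω ∈ openConn o a).card : ℝ) <
          1 / 2 * ∑ a ∈ A, (prodBernoulli w).real (openConn o a)} ≤
      s * (prodBernoulli w).real (⋃ a ∈ A, openConn o a) := by
  set μ := prodBernoulli w with hμ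
  set c : ℕ := ⌈1 / 2 * ∑ x ∈ A, μ.real (openConn o x)⌉₊ with hc
  -- integer threshold: `N < EN/2 ↔ N < c`
  have hthr : ∀ m : ℕ, (m : ℝ) < 1 / 2 * ∑ x ∈ A, μ.real (openConn o x) ↔ m < c := fun m => by
    rw [hc, Nat.lt_ceil]
  have hs : ∀ a ∈ A, μ.real {ω : BondConfig (Fin n) | (A.filter fun x => ω ∈ openConn a x).card < c} ≤ s := by
    intro a ha
    have hset : {ω : BondConfig (Fin n) | (A.filter fun x => ω ∈ openConn a x).card < c} =
        {ω : BondConfig (Fin n) | ((A.filter fun x => ω ∈ openConn a x).card : ℝ) <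
          1 / 2 * ∑ x ∈ A, μ.real (openConn o x)} := by
      ext ω
      simp only [Set.mem_setOf_eq]
      exact (hthr _).symm
    rw [hset]
    exact hmin a ha
  have hsub : {ω : BondConfig (Fin n) | 1 ≤ (A.filter fun a => ω ∈ openConn o a).card ∧
        ((A.filter fun a => ω ∈ openConn o a).card : ℝ) < 1 / 2 * ∑ a ∈ A, μ.real (openConn o a)} ⊆
      (⋃ a ∈ A, openConn o a) ∩ {ω : BondConfig (Fin n) | (A.filter fun a => ω ∈ openConn o a).card < c} := by
    intro ω hω
    obtain ⟨h1, h2⟩ := hω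
    refine ⟨?_, ?_⟩
    · obtain ⟨a, ha⟩ := Finset.card_pos.1 h1
      rw [Finset.mem_filter] at ha
      exact Set.mem_biUnion (Finset.mem_coe.2 ha.1) ha.2
    · simp only [Set.mem_setOf_eq]
      exact (hthr _).1 h2
  exact (measureReal_mono hsub (measure_ne_top _ _)).trans (lowerTail_le_worstRelay n w A o c s hs)

/-- **`Quant.QuantLowerTailGluing 1` from MIN-EN′** (conditional reduction; the hypothesis is stated verbatim, not as a named fact):
if on every finite weighted graph, for every relay set `A`, observer `o ∉ A`, relay `a ∈ A` and slack `s ≥ 0` bounding every `μ(x ↮ y)`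
(`x, y ∈ A`) one has `μ(#{x ∈ A : a ↔ x} < EN_o/2) ≤ s`, then `P(1 ≤ N < EN/2) ≤ 1·(P(o ↮ A) + s)` on every finite weighted graph,
i.e. the sharp constant `C = 1`.  So the census memo's open core MIN-EN′ is exactly what separates the tree from `QuantLowerTailGluing 1`.
[cite: KozmaNitzan2024, Conjecture 3 (p. 15)] -/
theorem quantLowerTailGluing_one_of_minRelay
    (hmin : ∀ (n : ℕ) (w : Sym2 (Fin n) → unitInterval) (A : Finset (Fin n)) (o a : Fin n) (s : ℝ), o ∉ A → a ∈ A → 0 ≤ s →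
      (∀ x ∈ A, ∀ y ∈ A, (prodBernoulli w).real (openConn x y : Set (BondConfig (Fin n)))ᶜ ≤ s) →
      (prodBernoulli w).real {ω : BondConfig (Fin n) |
        ((A.filter fun x => ω ∈ openConn a x).card : ℝ) < 1 / 2 * ∑ x ∈ A, (prodBernoulli w).real (openConn o x)} ≤ s) :
    Quant.QuantLowerTailGluing 1 := by
  intro n w A o s ho hs0 hs
  have h := linearLowerTail_mean_one_of_minRelay n w A o s fun a ha => hmin n w A o a s ho ha hs0 hs
  have hU1 : (prodBernoulli w).real (⋃ a ∈ A, (openConn o a : Set (BondConfig (Fin n)))) ≤ 1 := measureReal_le_one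
  have hc0 : 0 ≤ (prodBernoulli w).real (⋃ a ∈ A, (openConn o a : Set (BondConfig (Fin n))))ᶜ := measureReal_nonneg
  nlinarith [h, hU1, hc0, hs0]

end QuantCensus

end Summit.CriticalPhenomena.PercolationContinuityZ3.Theorems

end
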